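import Literature.AnabelianGeometry.EtaleTheta.BiKummer
import Literature.AlgebraicGeometry.Frobenioids.ModelFrobenioidPreSteps

/-!
# [EtTh] Remark 4.1.1, first clause: `G · μ_N(A)` acts over a morphism of base-Frobenius type

Mochizuki, *The étale theta function …*, Publ. RIMS **45** (2009), §4, Remark 4.1.1, PDF p.88
[cite: MochizukiEtTh2009, Rmk 4.1.1 p.88]: "if `α : A → B` is of base-Frobenius type, then … `A → B`
is a categorical quotient of `A` by the subgroup `G · μ_N(A) ⊆ Aut_C(A)` in the full subcategory of `C`
determined by the Frobenius-trivial objects".  abc-iut cell, layer L2 (seat abc-iut-L6-t12); the named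
`Prop` is abc-iut-L2-t3's `BiKummerSetting.Remark411` (`BiKummer.lean`), a conjunction of
(1) "`G · μ_N(A)` acts over `α`" (`γ ∘ α = α`) and (2) the universal property among Frobenius-trivial
test objects.  PROVED here: conjunct (1), for the model Frobenioid `C = S.tf.category` ([FrdI] Thm. 5.2):
`G ⊆ Aut_{C_B}(α)` by definition, and an `N`-torsion unit `σ ∈ μ_N(A)`, `N = deg_Fr(α)`, satisfies
`α ∘ σ = α` because `u_{α ∘ σ} = u_α · u_σ^N = u_α` and `Div(σ) = 0` (`Φ` divisorial).  Conjunct (2)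
uses the categorical quotient `A^bs → B^bs` by `Gal(A^bs/B^bs)` in `D` and [FrdI] Thm. 5.1 (iii), which
the abstract base category of the typed setting does not provide — not proved here (typed ≠ proved).
-/

noncomputable section

namespace Literature.AnabelianGeometry.EtaleTheta

open CategoryTheory Opposite Literature.AlgebraicGeometry.Frobenioids

universe u₀ v₀ u v w

variable {K : Type u₀} [Field K]

namespace BiKummerSetting

variable {X : SemiGraphs.TemperedArithmeticGroup.{u₀} K} {D₀ : Type u₀} [Category.{v₀} D₀]
  {V : FrdIMonoidStub.{w}} {T : RealifiedDivisorMonoids (D₀ := D₀) V} {D : Type u} [Category.{v} D]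
  {VD : FrdICatStub.{u, v, w} D} (S : BiKummerSetting X T D VD)

/-- An `N`-torsion unit acts trivially on the right of a morphism of Frobenius degree `N`:
for `σ ∈ μ_N(A)` and `α : A → B` with `deg_Fr(α) = N`, `α ∘ σ = α` (`u_{α∘σ} = u_α · u_σ^N`, `Div(σ) = 0`;
`Φ` divisorial). [cite: MochizukiEtTh2009, Rmk 4.1.1 p.88] -/
theorem hom_comp_eq_of_mem_mu (hΦd : Objectwise (fun M _ => IsDivisorial M) S.tf.divisorMonoid)
    {A B : S.C} (α : A ⟶ B) {σ : Aut A} (hσ : σ ∈ S.mu A (S.degFr α)) : σ.hom ≫ α = α := by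
  have hu : σ ∈ S.units A := hσ.1
  have hb : ModelFrobenioid.baseMap σ.hom = 𝟙 _ := hu.1
  have h1 : ModelFrobenioid.degFr σ.hom = 1 := hu.2
  have hN : σ ^ (ModelFrobenioid.degFr α : ℕ) = 1 := hσ.2
  -- `u_σ ^ N = 1` through `O^×(A) → B(A_D)^×`
  have hpow : ModelFrobenioid.unit σ.hom ^ (ModelFrobenioid.degFr α : ℕ) = 1 := by
    let σ' : ModelFrobenioid.units A := ⟨σ, hu⟩
    have e : σ' ^ (ModelFrobenioid.degFr α : ℕ) = 1 := Subtype.ext hN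
    have e' := congrArg (fun x => ((ModelFrobenioid.unitsToRatFn A x : (S.tf.ratFnFunctor.obj (op A.base))ˣ) :
      S.tf.ratFnFunctor.obj (op A.base))) e
    simpa [map_pow, Units.val_pow_eq_pow_val] using e'
  apply ModelFrobenioid.hom_ext
  · rw [ModelFrobenioid.degFr_comp, h1, mul_one]
  · rw [ModelFrobenioid.baseMap_comp, hb, Category.id_comp]
  · rw [ModelFrobenioid.div_comp_pull, hb, pull_id,
      ModelFrobenioid.div_eq_one_of_mem_units (hΦd A.base).isSharp hu, one_pow, mul_one]
  · rw [ModelFrobenioid.unit_comp_pull, hb, pull_id, hpow, mul_one]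

/-- **Remark 4.1.1, first clause** (p.88): for `α : A → B` of base-Frobenius type with data `(G, α', α'')`,
the subgroup `G · μ_N(A) ⊆ Aut_C(A)` (`N = deg_Fr(α)`) acts over `α`: `α ∘ γ = α` for every `γ` in it —
`G ⊆ Aut_{C_B}(α)` by Def. 4.1 (iv), and `μ_N(A)` by `hom_comp_eq_of_mem_mu`.  This is the first conjunct
of the named fact `Remark411`; the categorical-quotient conjunct is not proved here.
[cite: MochizukiEtTh2009, Rmk 4.1.1 p.88] -/
theorem remark411_actsOver (hΦd : Objectwise (fun M _ => IsDivisorial M) S.tf.divisorMonoid)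
    {A B : S.C} (α : A ⟶ B) (d : S.BaseFrobeniusTypeData α) :
    ∀ γ ∈ d.G ⊔ Subgroup.closure (S.mu A (S.degFr α)), γ.hom ≫ α = α := by
  have hle : d.G ⊔ Subgroup.closure (S.mu A (S.degFr α)) ≤ S.autOver α :=
    sup_le d.G_le ((Subgroup.closure_le _).mpr fun σ hσ => S.hom_comp_eq_of_mem_mu hΦd α hσ)
  intro γ hγ
  exact hle hγ

end BiKummerSetting

end Literature.AnabelianGeometry.EtaleTheta

end
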